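import Summits.MatrixMultiplication.OmegaCensus.STPP211CosetEngine

/-!
# (2,1,1)¹⁰ ⊄ (ℤ/2)⁶ — part F: the DIRECT kernel engine for the hard `c`-classes (definitions only)

Cell `pub-omega` (unit `pub-omega-stpp-1-g36`), topic `Summits/MatrixMultiplication/OmegaCensus`.
HONEST FRAMING (verbatim): lottery ticket; floor = certified bounds/negative ranges. Census STRUCTURE bookkeeping (B5, `T1((ℤ/2)⁶)`, Pb237);
nothing here is a bound on `ω`.

For the 11 affine classes of 10-point `c`-sets of `𝔽₂⁶` that the coset law does not kill (`STPP211Z2pow6CosetKills`), a normal-form family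
`(Aᵢ, {0}, {cᵢ})` is searched DIRECTLY as a labeled point set in all of `𝔽₂⁶` (the pairwise law of CKSU Def. 5.1, `T1Coset.nf_pairwise`):
every label exactly twice. Same SALTED packed-lane states as `STPP211CosetEngine` v2 with the trivial hyperplane `W = wmask 6 = ` all 64
codes (lane `t` of the state = the codes still admissible for block `t`). Differences to `goS`: (i) the open labels are a LIST `os` and the
label branched on is CHOSEN — the open label with the fewest candidates (`pickMin`, all-lanes SWAR popcount; any choice inside `os` is sound);
(ii) the union of the open lanes must hold `2 · |os|` codes (`hasBits`; the `A`-sets still to be placed are disjoint) — otherwise the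
node is refuted; (iii) the chosen label `u` receives exactly two points
`x < y` from its lane. `rootD cs d`: block `0` (the block with `c = 0`, listed first) is `{0, d}` (translation normal form), the other nine
labels open. Desk twin: HOME `pub-omega-stpp-1-g36/code/t1sym.c` (rule 1, count prune A) / `direct_mirror.py`.

References: H. Cohn, R. Kleinberg, B. Szegedy, C. Umans, FOCS 2005 (arXiv:math/0511460), Def. 5.1.
-/

namespace Summit.MatrixMultiplication.OmegaCensus

namespace T1CosetEng

open STPP211Neg

/-! ## Readers -/

/-- The byte masks `0x55…`, `0x33…`, `0x0F…` spread over `k + 1` fields of 64 bits (for the all-lanes SWAR popcount). -/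
noncomputable def rep8 (k byte : ℕ) : ℕ := pack 8 (fun _ => byte) (Nat.mul 8 (Nat.add k 1))

/-- ALL-LANES SWAR popcount: byte `8 (t+1) + 7` of the result is the number of set bits of lane `t` (heuristic only — it steers the choice of
the branching label and never enters a verdict). -/
noncomputable def popK (k K : ℕ) : ℕ :=
  force (Nat.sub K (Nat.land (Nat.shiftRight K 1) (rep8 k 85))) fun v1 =>
  force (Nat.add (Nat.land v1 (rep8 k 51)) (Nat.land (Nat.shiftRight v1 2) (rep8 k 51))) fun v2 =>
  force (Nat.land (Nat.add v2 (Nat.shiftRight v2 4)) (rep8 k 15)) fun v3 =>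
  Nat.mul v3 72340172838076673

/-- The popcount byte of lane `t` in `popK`. -/
def popByte (P t : ℕ) : ℕ := Nat.land (Nat.shiftRight P (Nat.add (Nat.mul 64 (Nat.add t 1)) 56)) 255

/-- The KEY of an open label: `16 · #lane + v` (labels `< 16`). -/
def keyOf (P v : ℕ) : ℕ := Nat.add (Nat.mul 16 (popByte P v)) v

/-- The least key over a list of labels (`100000` for the empty list). -/
noncomputable def minKey (P : ℕ) : List ℕ → ℕ :=
  @List.rec ℕ (fun _ => ℕ) 100000 (fun v _ acc => force (keyOf P v) fun key => @Bool.rec (fun _ => ℕ) acc key (Nat.blt key acc))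

/-- The open label with the fewest candidates: the least key, read back modulo `16`. -/
noncomputable def pickMin (k K : ℕ) (os : List ℕ) : ℕ :=
  force (popK k K) fun P => Nat.mod (minKey P os) 16

/-- Union of the open lanes. -/
def unionL (K : ℕ) : List ℕ → ℕ :=
  @List.rec ℕ (fun _ => ℕ) 0 (fun v _ acc => Nat.lor (laneS K v) acc)

/-- `os` without the label `u`. -/
def dropL (u : ℕ) (os : List ℕ) : List ℕ := os.filter fun v => !(Nat.beq v u)

/-! ## The direct search -/

/-- THE DIRECT SEARCH. `goD k tabs fuel os K`: open labels `os` (each still needs its two points), salted lanes `K`; `true` = refuted.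
Node: the open lanes together have `< 2|os|` codes ⇒ refuted (the `A`-pairs still to be placed are disjoint); else for the open label `u`
with the fewest candidates, every pair `x < y` of its lane (`y` compatible with `x`) leads to a refuted child (a lane with `< 2` codes has no
pair: refuted). `os = []` is a full family: `false`. -/
noncomputable def goD (k : ℕ) (tabs : List ℕ) : ℕ → List ℕ → ℕ → Bool :=
  @Nat.rec (fun _ => List ℕ → ℕ → Bool) (fun _ _ => false)
    (fun _ ih os K =>
      @List.rec ℕ (fun _ => Bool) false
        (fun _ _ _ =>
          !(hasBits (Nat.mul 2 os.length) (unionL K os)) ||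
          (force (pickMin k K os) fun u =>
           force (tabs.getD u 0) fun Tu =>
           force (laneS K u) fun L =>
           allBits L (fun x =>
             force (Nat.land (Nat.xor K (salt u x)) (lvS k Tu x)) fun K1 =>
             force (Nat.land (laneS K1 u) (Nat.xor full6 (lowMask (Nat.add x 1)))) fun L2 =>
             allBits L2 (fun y => ih (dropL u os) (Nat.land (Nat.xor K1 (salt u y)) (lvS k Tu y))) L2)
           L))
        os)

/-- The open labels `1, …, k−1`. -/
def openOf (k : ℕ) : List ℕ := restOf k 0

/-- THE ROOT OF A CLASS AT `d`: block `0` is `{0, d}` (its `c` is `cs[0] = 0`); lanes for the other labels, then `goD`. Uses the coset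
tables with `W = wmask 6` (all codes). -/
noncomputable def rootD (cs : List ℕ) (d : ℕ) : Bool :=
  force cs.length fun k =>
  force (wmask 6) fun W =>
  force ((mkTabsS cs W k).getD 0 0) fun T0 =>
  force (Nat.land (Nat.xor (lvS k T0 0) (salt 0 d)) (lvS k T0 d)) fun Kd =>
  goD k (mkTabsS cs W k) k (openOf k) Kd

end T1CosetEng

end Summit.MatrixMultiplication.OmegaCensus
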